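import Summits.ABC.ABC.Theorems.PrimePowerRadical.Negative.Orders

/-!
# Primes of small multiplicative order are few (Erdős–Murty, weak form)

Stub `stub_card_small_order` of the line `Sketch` (card `adelic-brjuno-summability`, crux stmt-ABC-1648,
wave 2: the metric calibration of the open stub `stub_wdc`, Transfer (c)).

Informal statement: for `q ≥ 2` and `y ≥ 0`, any finite set `U` of primes `p ∤ q` with `ord_p(q) ≤ y` has
at most `y² · (⌊log₂ q⌋ + 1)` elements. This is the counting companion of the landed pointwise lemma
`atz_prime_le_of_ordMod_lt` ("primes of small order are small").

Proof (pure `ℕ` arithmetic). Every `p ∈ U` divides `q^{ord_p(q)} − 1`, and `1 ≤ ord_p(q) ≤ y`, so `p`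
divides `N := ∏_{1 ≤ d ≤ y} (q^d − 1) > 0`; hence `U ⊆ primeFactors N` and
`2^{#U} ≤ 2^{#primeFactors N} ≤ ∏_{p ∣ N} p ≤ N ≤ ∏_{1 ≤ d ≤ y} q^y = q^{y·y} ≤ (2^{⌊log₂ q⌋+1})^{y·y}`,
and comparing exponents of `2` gives the claim (the case `y = 0` is the degenerate instance `N = 1`).

NOT here: the sharper Erdős–Murty bound `O(y²/log y)`, any real-analytic form, and the use of this count
in the summability transfer — those belong to the lead's skeleton and the other stubs of the line.
-/

noncomputable section

-- `Summit.<Summit>.<Problem>` is the mandated summit-side namespace (CONVENTIONS §2); for the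
-- single-conjunct summit `ABC` the two coincide, so the duplicate `ABC.ABC` is deliberate.
set_option linter.dupNamespace false

namespace Summit.ABC.ABC.Theorems.PrimePowerRadical.Brjuno

open Literature.NumberTheory.DiophantineGeometry UniqueFactorizationMonoid
open Summit.ABC.ABC.Theses.IneffectiveSubspace
open Summit.ABC.ABC.Theorems.PrimePowerRadical.Negative
open scoped BigOperators

/-- The product `∏_{1 ≤ d ≤ y} (q^d − 1)` is positive for `q ≥ 2`. -/
theorem eso_prod_pow_sub_one_pos {q : ℕ} (hq : 2 ≤ q) (y : ℕ) :
    0 < ∏ d ∈ Finset.Icc 1 y, (q ^ d - 1) := by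
  apply Finset.prod_pos
  intro d hd
  have hd1 : 1 ≤ d := (Finset.mem_Icc.mp hd).1
  have := two_le_pow hq hd1
  omega

/-- The product `∏_{1 ≤ d ≤ y} (q^d − 1)` is at most `q^{y·y}`. -/
theorem eso_prod_pow_sub_one_le {q : ℕ} (hq : 2 ≤ q) (y : ℕ) :
    ∏ d ∈ Finset.Icc 1 y, (q ^ d - 1) ≤ q ^ (y * y) := by
  calc ∏ d ∈ Finset.Icc 1 y, (q ^ d - 1) ≤ ∏ _d ∈ Finset.Icc 1 y, q ^ y := by
        apply Finset.prod_le_prod' fun d hd => ?_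
        have hdy : d ≤ y := (Finset.mem_Icc.mp hd).2
        exact le_trans (Nat.sub_le _ _) (Nat.pow_le_pow_right (by omega) hdy)
    _ = q ^ (y * y) := by
        rw [Finset.prod_const, Nat.card_Icc, Nat.add_sub_cancel, ← pow_mul]

/-- **Primes of small multiplicative order are few** (Erdős–Murty, weak form): for `q ≥ 2`, a finite set of
primes `p ∤ q` with `ord_p(q) ≤ y` has at most `y² · (⌊log₂ q⌋ + 1)` elements. -/
theorem stub_card_small_order {q y : ℕ} (hq : 2 ≤ q) (U : Finset ℕ)
    (hU : ∀ p ∈ U, p.Prime ∧ ¬ p ∣ q ∧ ordMod q p ≤ y) :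
    U.card ≤ y * y * (Nat.log 2 q + 1) := by
  set N : ℕ := ∏ d ∈ Finset.Icc 1 y, (q ^ d - 1) with hN
  have hNpos : 0 < N := eso_prod_pow_sub_one_pos hq y
  -- every `p ∈ U` is a prime factor of `N`
  have hsub : U ⊆ N.primeFactors := by
    intro p hp
    obtain ⟨hpr, hpq, hpy⟩ := hU p hp
    have hd : 0 < ordMod q p := ordMod_pos hpr hpq
    have hpd : p ∣ q ^ ordMod q p - 1 :=
      (dvd_pow_sub_one_iff_ordMod_dvd hpr (by omega) _).mpr dvd_rfl
    have hmem : ordMod q p ∈ Finset.Icc 1 y := Finset.mem_Icc.mpr ⟨hd, hpy⟩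
    exact Nat.mem_primeFactors.mpr
      ⟨hpr, dvd_trans hpd (Finset.dvd_prod_of_mem (fun d => q ^ d - 1) hmem), hNpos.ne'⟩
  -- `N` has at most `log₂ N` prime factors: `2^{#primeFactors N} ≤ ∏_{p ∣ N} p ≤ N`
  have hcard : 2 ^ N.primeFactors.card ≤ N :=
    calc 2 ^ N.primeFactors.card ≤ ∏ p ∈ N.primeFactors, p :=
          Finset.pow_card_le_prod _ _ _ fun _ hp => (Nat.prime_of_mem_primeFactors hp).two_le
      _ ≤ N := Nat.le_of_dvd hNpos (Nat.prod_primeFactors_dvd N)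
  -- `q ≤ 2^{⌊log₂ q⌋ + 1}`
  have hq2 : q ≤ 2 ^ (Nat.log 2 q + 1) := (Nat.lt_pow_succ_log_self Nat.one_lt_two q).le
  -- compare powers of `2`
  have hpow : 2 ^ U.card ≤ 2 ^ (y * y * (Nat.log 2 q + 1)) :=
    calc 2 ^ U.card ≤ 2 ^ N.primeFactors.card :=
          Nat.pow_le_pow_right Nat.two_pos (Finset.card_le_card hsub)
      _ ≤ N := hcard
      _ ≤ q ^ (y * y) := eso_prod_pow_sub_one_le hq y
      _ ≤ (2 ^ (Nat.log 2 q + 1)) ^ (y * y) := Nat.pow_le_pow_left hq2 _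
      _ = 2 ^ (y * y * (Nat.log 2 q + 1)) := by rw [← pow_mul]; ring
  exact (Nat.pow_le_pow_iff_right Nat.one_lt_two).mp hpow

end Summit.ABC.ABC.Theorems.PrimePowerRadical.Brjuno

end
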